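import Summits.Parity.GeneralizedHardyLittlewood.Theorems.BeyondDiagonalBeatsQuarter.OffDiagLevelPhaseCost
import Summits.Parity.GeneralizedHardyLittlewood.Theorems.BeyondDiagonalBeatsQuarter.OffDiagDualBoxSize
import HarnessLib

/-!
# Route `PrimeLevelFamEdge`, crux K_B (stmt-Parity-20343), line `diagonal_kernel_split` rev 4, plan Ω,
# node **L7c, part 4 — the level-factor FORM of a dual term: the level `q` sits in `Φ̂_{q,i}` only as
# `Ψ_t(1/q)` under the box integral** (OMEGA-BLUEPRINT v4 §3c; companion of `OffDiagLevelPhaseCost`)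

Exact rewrites, no estimates. For a layer `(d₁,d₂,r)` with frequency parameters `α, β`, a box `i` and the dual
point `(ξ₁, ξ₂) = (X₁/q, σ + X₂/q)` (after the block switch: `X₁ = h₁/c`, `σ = s/h₁`, `X₂ = ab/(h₁c)`):

* `layerWeightR_eq_levelFactor`, **`boxWeight_eq_levelFactor`** — `Φ_i(t₁,t₂) = [θ(t₁/K₁)θ(t₂/K₂)(d₁t₁d₂t₂)^{−1/2}r⁻¹]
  · W(a(t)/q) · J₁(b(t)/q)` with `a(t) = 4π²d₁t₁d₂t₂`, `b(t) = 4π√(αt₁βt₂)/r` (`q̂² = q/4π²`);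
* `ker_mul_ker_eq` — `e(−t₁X₁/q)·e(−t₂(σ + X₂/q)) = e(−t₂σ)·e(−κ(t)/q)`, `κ(t) = t₁X₁ + t₂X₂`;
* **`kernel_mul_boxWeight_eq`** — the Fourier integrand `e(−t₁ξ₁)e(−t₂ξ₂)Φ_i(t)` is `K(t)·Ψ_t(1/q)` with the
  `q`-FREE weight `K(t) = θθ·(d₁t₁d₂t₂)^{−1/2}r⁻¹·e(−t₂σ)` and the LEVEL FACTOR `Ψ_t(v) = W(a(t)v)J₁(b(t)v)e(−κ(t)v)`
  of `OffDiagLevelPhaseCost`;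
* `fourier2_eq_integral_integral` (`Φ̂(ξ₁,ξ₂) = ∫dt₁∫dt₂ e(−t₁ξ₁)e(−t₂ξ₂)Φ`), and
  **`fourier2_boxWeight_eq_integral_levelFactor`** — `Φ̂_{q,i}(X₁/q, σ + X₂/q) = ∫dt₁∫dt₂ K(t)·Ψ_t(1/q)`;
* **`sum_mul_fourier2_boxWeight_eq`** — a finite LEVEL SUM goes under the box integral:
  `Σ_{q∈S} c_q Φ̂_{q,i}(X₁/q, σ + X₂/q) = ∫dt₁∫dt₂ K(t)·Σ_{q∈S} c_q Ψ_t(1/q)` (`S` any finite set of levels `q ≥ 1`;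
  the integrability is that of the tree's `BoxSupport`/continuity kit for `Φ_i`), so that
  `OffDiagLevelPhaseCost.levelFactor_separation` applies POINTWISE in `t` to the inner level sum, with universal
  sequences `((1/q − t₀)/ℓ)^j` that do not depend on `t`;
* `norm_levelWeight_le` / `levelWeight_eq_zero` — `|K(t)| ≤ (d₁d₂(K₁/2)(K₂/2))^{−1/2}r⁻¹` on the box, `K = 0` off it.

Helper; closes nothing; standard axioms. «The programme SEARCHES and TYPES; no claim about Landau–Siegel zeros,
Theorems 1–2 of arXiv:2211.02515 or a repaired Margin232 until a kernel theorem says so.»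
-/

noncomputable section

open Finset Real Complex MeasureTheory
open scoped Nat Topology

namespace Summit.Parity.GeneralizedHardyLittlewood.Theorems.BeyondDiagonalBeatsQuarter.LevelSeparation

open Literature.Analysis.FunctionSpaces (besselJ)
open Literature.Analysis.Calculus.WhitneyConvex (dyadicBump dyadicBump_nonneg dyadicBump_le_one)
open Literature.NumberTheory.LFunctions.KMV2000 (cutoffW qhat qhat_sq)
open Literature.NumberTheory.Sieve.FriedlanderIwaniecPrimes (fourier2 sliceFourier ker norm_ker fourier_eq_integral_ker
  BoxSupport continuous_sliceFourier hasCompactSupport_sliceFourier sliceFourier_eq_zero)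
open OffDiag (boxWeight layerWeightR contDiff_uncurry_boxWeight boxSupport_boxWeight mem_box_of_bump₂_ne_zero)

/-! ### The box weight in level-factor form -/

/-- **The layer weight as a function of `v = 1/q`**: `g(y) = (d₁y₁d₂y₂)^{−1/2} r⁻¹ · W(a·q⁻¹)·J₁(b·q⁻¹)` with
`a = 4π²d₁y₁d₂y₂`, `b = 4π√(αy₁βy₂)/r` (`q̂² = q/4π²`). [cite: KowalskiMichelVanderKam2000, (21)–(23) p. 12 — derivation] -/
theorem layerWeightR_eq_levelFactor (q d₁ d₂ α β r : ℕ) (y₁ y₂ : ℝ) :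
    layerWeightR q d₁ d₂ α β r (y₁, y₂) =
      (((d₁ : ℝ) * y₁ * ((d₂ : ℝ) * y₂)) ^ (-(1 / 2 : ℝ)) * (r : ℝ)⁻¹) *
        (cutoffW ((4 * π ^ 2 * ((d₁ : ℝ) * y₁ * ((d₂ : ℝ) * y₂))) * ((q : ℝ))⁻¹) *
          besselJ 1 ((4 * π * Real.sqrt ((α : ℝ) * y₁ * ((β : ℝ) * y₂)) / r) * ((q : ℝ))⁻¹)) := by
  rw [layerWeightR]
  dsimp only
  have h1 : (d₁ : ℝ) * y₁ * ((d₂ : ℝ) * y₂) / qhat q ^ 2 =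
      (4 * π ^ 2 * ((d₁ : ℝ) * y₁ * ((d₂ : ℝ) * y₂))) * ((q : ℝ))⁻¹ := by
    rw [qhat_sq, div_div_eq_mul_div]
    ring
  have h2 : 4 * π * Real.sqrt ((α : ℝ) * y₁ * ((β : ℝ) * y₂)) / ((q : ℝ) * r) =
      (4 * π * Real.sqrt ((α : ℝ) * y₁ * ((β : ℝ) * y₂)) / r) * ((q : ℝ))⁻¹ := by
    rw [mul_comm (q : ℝ) r, ← div_div]
    ring
  rw [h1, h2]
  ring

/-- **The box weight in level-factor form**:
`Φ_i(y₁,y₂) = [θ(y₁/2^{i₁})θ(y₂/2^{i₂})·(d₁y₁d₂y₂)^{−1/2}r⁻¹] · (W(a/q) : ℂ) · (J₁(b/q) : ℂ)`.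
[cite: KowalskiMichelVanderKam2000, (21)–(23) p. 12 — derivation] -/
theorem boxWeight_eq_levelFactor (q d₁ d₂ α β r : ℕ) (i : ℕ × ℕ) (y₁ y₂ : ℝ) :
    boxWeight q d₁ d₂ α β r i y₁ y₂ =
      ((dyadicBump (y₁ / 2 ^ i.1) * dyadicBump (y₂ / 2 ^ i.2) *
          (((d₁ : ℝ) * y₁ * ((d₂ : ℝ) * y₂)) ^ (-(1 / 2 : ℝ)) * (r : ℝ)⁻¹) : ℝ) : ℂ) *
        (((cutoffW ((4 * π ^ 2 * ((d₁ : ℝ) * y₁ * ((d₂ : ℝ) * y₂))) * ((q : ℝ))⁻¹) : ℝ) : ℂ) *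
          ((besselJ 1 ((4 * π * Real.sqrt ((α : ℝ) * y₁ * ((β : ℝ) * y₂)) / r) * ((q : ℝ))⁻¹) : ℝ) : ℂ)) := by
  rw [boxWeight, layerWeightR_eq_levelFactor]
  push_cast
  ring

/-! ### The Fourier kernels -/

/-- **The two kernels at the dual point `(X₁/q, σ + X₂/q)`**: `e(−t₁X₁v)·e(−t₂(σ + X₂v)) = e(−t₂σ)·e(−κv)` with
`κ = t₁X₁ + t₂X₂` (here `v = 1/q`). [folklore] -/
theorem ker_mul_ker_eq (t₁ t₂ X₁ σ X₂ v : ℝ) :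
    ker t₁ (X₁ * v) * ker t₂ (σ + X₂ * v) =
      ker t₂ σ * Complex.exp (((-2 * π * (t₁ * X₁ + t₂ * X₂) * v : ℝ) : ℂ) * I) := by
  simp only [ker]
  rw [← Complex.exp_add, ← Complex.exp_add]
  congr 1
  push_cast
  ring

/-- **The Fourier integrand of a dual term is `K(t)·Ψ_t(1/q)`**: for `v = q⁻¹`,
`e(−t₁X₁v)·(e(−t₂(σ+X₂v))·Φ_i(t₁,t₂)) = K(t₁,t₂) · [W(a(t)v)·J₁(b(t)v)·e(−κ(t)v)]` with the `q`-free weight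
`K(t) = θθ·(d₁t₁d₂t₂)^{−1/2}r⁻¹·e(−t₂σ)`. [cite: KowalskiMichelVanderKam2000, (21)–(23) p. 12 — derivation] -/
theorem kernel_mul_boxWeight_eq (q d₁ d₂ α β r : ℕ) (i : ℕ × ℕ) (X₁ σ X₂ t₁ t₂ : ℝ) :
    ker t₁ (X₁ * ((q : ℝ))⁻¹) * (ker t₂ (σ + X₂ * ((q : ℝ))⁻¹) * boxWeight q d₁ d₂ α β r i t₁ t₂) =
      (((dyadicBump (t₁ / 2 ^ i.1) * dyadicBump (t₂ / 2 ^ i.2) *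
            (((d₁ : ℝ) * t₁ * ((d₂ : ℝ) * t₂)) ^ (-(1 / 2 : ℝ)) * (r : ℝ)⁻¹) : ℝ) : ℂ) * ker t₂ σ) *
        (((cutoffW ((4 * π ^ 2 * ((d₁ : ℝ) * t₁ * ((d₂ : ℝ) * t₂))) * ((q : ℝ))⁻¹) : ℝ) : ℂ) *
          ((besselJ 1 ((4 * π * Real.sqrt ((α : ℝ) * t₁ * ((β : ℝ) * t₂)) / r) * ((q : ℝ))⁻¹) : ℝ) : ℂ) *
            Complex.exp (((-2 * π * (t₁ * X₁ + t₂ * X₂) * ((q : ℝ))⁻¹ : ℝ) : ℂ) * I)) := by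
  rw [boxWeight_eq_levelFactor, ← mul_assoc (ker t₁ _), ker_mul_ker_eq]
  ring

/-! ### `Φ̂` as an iterated integral, and the level sum under the box integral -/

/-- `Φ̂(ξ₁,ξ₂) = ∫ dt₁ ∫ dt₂ e(−t₁ξ₁)·(e(−t₂ξ₂)·Φ(t₁,t₂))` (definitions unfolded). [folklore] -/
theorem fourier2_eq_integral_integral (Φ : ℝ → ℝ → ℂ) (ξ₁ ξ₂ : ℝ) :
    fourier2 Φ ξ₁ ξ₂ = ∫ t₁, ∫ t₂, ker t₁ ξ₁ * (ker t₂ ξ₂ * Φ t₁ t₂) := by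
  rw [fourier2, fourier_eq_integral_ker]
  refine integral_congr_ae (Filter.Eventually.of_forall fun t₁ => ?_)
  dsimp only
  rw [sliceFourier, fourier_eq_integral_ker, ← integral_const_mul]

/-- **A dual term in level-factor form**: `Φ̂_{q,i}(X₁/q, σ + X₂/q) = ∫dt₁∫dt₂ K(t)·Ψ_t(1/q)`.
[cite: KowalskiMichelVanderKam2000, (21)–(23) p. 12 — derivation] -/
theorem fourier2_boxWeight_eq_integral_levelFactor (q d₁ d₂ α β r : ℕ) (i : ℕ × ℕ) (X₁ σ X₂ : ℝ) :
    fourier2 (boxWeight q d₁ d₂ α β r i) (X₁ * ((q : ℝ))⁻¹) (σ + X₂ * ((q : ℝ))⁻¹) =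
      ∫ t₁, ∫ t₂, (((dyadicBump (t₁ / 2 ^ i.1) * dyadicBump (t₂ / 2 ^ i.2) *
            (((d₁ : ℝ) * t₁ * ((d₂ : ℝ) * t₂)) ^ (-(1 / 2 : ℝ)) * (r : ℝ)⁻¹) : ℝ) : ℂ) * ker t₂ σ) *
        (((cutoffW ((4 * π ^ 2 * ((d₁ : ℝ) * t₁ * ((d₂ : ℝ) * t₂))) * ((q : ℝ))⁻¹) : ℝ) : ℂ) *
          ((besselJ 1 ((4 * π * Real.sqrt ((α : ℝ) * t₁ * ((β : ℝ) * t₂)) / r) * ((q : ℝ))⁻¹) : ℝ) : ℂ) *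
            Complex.exp (((-2 * π * (t₁ * X₁ + t₂ * X₂) * ((q : ℝ))⁻¹ : ℝ) : ℂ) * I)) := by
  rw [fourier2_eq_integral_integral]
  refine integral_congr_ae (Filter.Eventually.of_forall fun t₁ => ?_)
  refine integral_congr_ae (Filter.Eventually.of_forall fun t₂ => ?_)
  exact kernel_mul_boxWeight_eq q d₁ d₂ α β r i X₁ σ X₂ t₁ t₂

section Integrability

variable {q d₁ d₂ α β r : ℕ}

/-- The `t₂`-integrand of a dual term is integrable (continuous with compact support). [folklore] -/
theorem integrable_kernel_mul_boxWeight [NeZero q] (hd₁ : 1 ≤ d₁) (hd₂ : 1 ≤ d₂) (hα : 1 ≤ α) (hβ : 1 ≤ β)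
    (i : ℕ × ℕ) (ξ₁ ξ₂ t₁ : ℝ) :
    Integrable (fun t₂ : ℝ => ker t₁ ξ₁ * (ker t₂ ξ₂ * boxWeight q d₁ d₂ α β r i t₁ t₂)) := by
  have hB := boxSupport_boxWeight (q := q) (d₁ := d₁) (d₂ := d₂) (α := α) (β := β) (r := r) i
  have hcont : Continuous (Function.uncurry (boxWeight q d₁ d₂ α β r i)) :=
    (contDiff_uncurry_boxWeight (q := q) (r := r) hd₁ hd₂ hα hβ i).continuous
  have hc : Continuous fun t₂ : ℝ => ker t₁ ξ₁ * (ker t₂ ξ₂ * boxWeight q d₁ d₂ α β r i t₁ t₂) := by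
    have h1 : Continuous fun t₂ : ℝ => boxWeight q d₁ d₂ α β r i t₁ t₂ := hcont.uncurry_left t₁
    have h2 : Continuous fun t₂ : ℝ => ker t₂ ξ₂ :=
      Literature.NumberTheory.Sieve.FriedlanderIwaniecPrimes.continuous_ker.comp
        (continuous_id.prodMk continuous_const)
    exact continuous_const.mul (h2.mul h1)
  refine hc.integrable_of_hasCompactSupport ?_
  refine HasCompactSupport.intro (isCompact_Icc (a := -(2 * ((2 : ℝ) ^ i.1 + 2 ^ i.2)))
    (b := 2 * ((2 : ℝ) ^ i.1 + 2 ^ i.2))) fun t₂ ht₂ => ?_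
  have h0 : boxWeight q d₁ d₂ α β r i t₁ t₂ = 0 := by
    by_contra hne
    exact ht₂ (Set.mem_Icc.mpr (abs_le.mp (hB t₁ t₂ hne).2))
  simp [h0]

/-- The `t₁`-integrand `t₁ ↦ ∫dt₂ …` of a dual term is integrable (it is `e(−t₁ξ₁)·Ψ_{ξ₂}(t₁)`, continuous
with compact support). [folklore] -/
theorem integrable_integral_kernel_mul_boxWeight [NeZero q] (hd₁ : 1 ≤ d₁) (hd₂ : 1 ≤ d₂) (hα : 1 ≤ α)
    (hβ : 1 ≤ β) (i : ℕ × ℕ) (ξ₁ ξ₂ : ℝ) :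
    Integrable (fun t₁ : ℝ => ∫ t₂, ker t₁ ξ₁ * (ker t₂ ξ₂ * boxWeight q d₁ d₂ α β r i t₁ t₂)) := by
  have hB := boxSupport_boxWeight (q := q) (d₁ := d₁) (d₂ := d₂) (α := α) (β := β) (r := r) i
  have hcont : Continuous (Function.uncurry (boxWeight q d₁ d₂ α β r i)) :=
    (contDiff_uncurry_boxWeight (q := q) (r := r) hd₁ hd₂ hα hβ i).continuous
  have heq : (fun t₁ : ℝ => ∫ t₂, ker t₁ ξ₁ * (ker t₂ ξ₂ * boxWeight q d₁ d₂ α β r i t₁ t₂)) =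
      fun t₁ : ℝ => ker t₁ ξ₁ * sliceFourier (boxWeight q d₁ d₂ α β r i) ξ₂ t₁ := by
    funext t₁
    rw [integral_const_mul, sliceFourier, fourier_eq_integral_ker]
  rw [heq]
  have hc : Continuous fun t₁ : ℝ => ker t₁ ξ₁ * sliceFourier (boxWeight q d₁ d₂ α β r i) ξ₂ t₁ :=
    (Literature.NumberTheory.Sieve.FriedlanderIwaniecPrimes.continuous_ker.comp
      (continuous_id.prodMk continuous_const)).mul (continuous_sliceFourier hB hcont ξ₂)
  refine hc.integrable_of_hasCompactSupport ?_
  refine HasCompactSupport.intro (isCompact_Icc (a := -(2 * ((2 : ℝ) ^ i.1 + 2 ^ i.2)))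
    (b := 2 * ((2 : ℝ) ^ i.1 + 2 ^ i.2))) fun t₁ ht₁ => ?_
  have h0 : sliceFourier (boxWeight q d₁ d₂ α β r i) ξ₂ t₁ = 0 := by
    refine sliceFourier_eq_zero hB ξ₂ ?_
    by_contra hle
    exact ht₁ (Set.mem_Icc.mpr (abs_le.mp (not_lt.mp hle)))
  simp [h0]

end Integrability

/-- **A finite level sum goes under the box integral.** For a finite set `S` of levels `q ≥ 1`, complex weights
`c_q`, and the dual point `(X₁/q, σ + X₂/q)`:
`Σ_{q∈S} c_q·Φ̂_{q,i}(X₁/q, σ + X₂/q) = ∫dt₁∫dt₂ K(t)·Σ_{q∈S} c_q·Ψ_t(1/q)` with the `q`-free weight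
`K(t) = θθ·(d₁t₁d₂t₂)^{−1/2}r⁻¹·e(−t₂σ)` and the level factor `Ψ_t(v) = W(a(t)v)J₁(b(t)v)e(−κ(t)v)`.
[cite: KowalskiMichelVanderKam2000, (21)–(23) p. 12 — derivation] -/
theorem sum_mul_fourier2_boxWeight_eq {d₁ d₂ α β r : ℕ} (hd₁ : 1 ≤ d₁) (hd₂ : 1 ≤ d₂) (hα : 1 ≤ α)
    (hβ : 1 ≤ β) (i : ℕ × ℕ) (X₁ σ X₂ : ℝ) (S : Finset ℕ) (hS : ∀ q ∈ S, q ≠ 0) (c : ℕ → ℂ) :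
    ∑ q ∈ S, c q * fourier2 (boxWeight q d₁ d₂ α β r i) (X₁ * ((q : ℝ))⁻¹) (σ + X₂ * ((q : ℝ))⁻¹) =
      ∫ t₁, ∫ t₂, (((dyadicBump (t₁ / 2 ^ i.1) * dyadicBump (t₂ / 2 ^ i.2) *
            (((d₁ : ℝ) * t₁ * ((d₂ : ℝ) * t₂)) ^ (-(1 / 2 : ℝ)) * (r : ℝ)⁻¹) : ℝ) : ℂ) * ker t₂ σ) *
        ∑ q ∈ S, c q *
          (((cutoffW ((4 * π ^ 2 * ((d₁ : ℝ) * t₁ * ((d₂ : ℝ) * t₂))) * ((q : ℝ))⁻¹) : ℝ) : ℂ) *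
            ((besselJ 1 ((4 * π * Real.sqrt ((α : ℝ) * t₁ * ((β : ℝ) * t₂)) / r) * ((q : ℝ))⁻¹) : ℝ) : ℂ) *
              Complex.exp (((-2 * π * (t₁ * X₁ + t₂ * X₂) * ((q : ℝ))⁻¹ : ℝ) : ℂ) * I)) := by
  -- the integrand of level `q`
  set F : ℕ → ℝ → ℝ → ℂ := fun q t₁ t₂ =>
    ker t₁ (X₁ * ((q : ℝ))⁻¹) * (ker t₂ (σ + X₂ * ((q : ℝ))⁻¹) * boxWeight q d₁ d₂ α β r i t₁ t₂) with hF
  have hint₂ : ∀ q ∈ S, ∀ t₁ : ℝ, Integrable (fun t₂ : ℝ => c q * F q t₁ t₂) := by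
    intro q hq t₁
    haveI : NeZero q := ⟨hS q hq⟩
    exact (integrable_kernel_mul_boxWeight (q := q) (r := r) hd₁ hd₂ hα hβ i _ _ t₁).const_mul (c q)
  have hint₁ : ∀ q ∈ S, Integrable (fun t₁ : ℝ => ∫ t₂, c q * F q t₁ t₂) := by
    intro q hq
    haveI : NeZero q := ⟨hS q hq⟩
    have h := (integrable_integral_kernel_mul_boxWeight (q := q) (r := r) hd₁ hd₂ hα hβ i
      (X₁ * ((q : ℝ))⁻¹) (σ + X₂ * ((q : ℝ))⁻¹)).const_mul (c q)
    refine h.congr (Filter.Eventually.of_forall fun t₁ => ?_)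
    dsimp only
    rw [← integral_const_mul]
  -- step 1: each term as an iterated integral
  have h1 : ∀ q ∈ S, c q * fourier2 (boxWeight q d₁ d₂ α β r i) (X₁ * ((q : ℝ))⁻¹) (σ + X₂ * ((q : ℝ))⁻¹) =
      ∫ t₁, ∫ t₂, c q * F q t₁ t₂ := by
    intro q _
    rw [fourier2_eq_integral_integral, ← integral_const_mul]
    refine integral_congr_ae (Filter.Eventually.of_forall fun t₁ => ?_)
    dsimp only
    rw [← integral_const_mul]
  rw [Finset.sum_congr rfl h1, ← integral_finsetSum _ hint₁]
  refine integral_congr_ae (Filter.Eventually.of_forall fun t₁ => ?_)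
  dsimp only
  rw [← integral_finsetSum _ (fun q hq => hint₂ q hq t₁)]
  refine integral_congr_ae (Filter.Eventually.of_forall fun t₂ => ?_)
  dsimp only
  rw [Finset.mul_sum]
  refine Finset.sum_congr rfl fun q _ => ?_
  rw [hF]
  dsimp only
  rw [kernel_mul_boxWeight_eq]
  ring

/-! ### The `q`-free weight `K` -/

/-- **`K` vanishes off the box** `[K₁/2, 2K₁] × [K₂/2, 2K₂]` (`K_j = 2^{i_j}`). [folklore] -/
theorem levelWeight_eq_zero (d₁ d₂ r : ℕ) (i : ℕ × ℕ) (σ : ℝ) {t₁ t₂ : ℝ}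
    (h : (t₁, t₂) ∉ Set.Icc ((2 : ℝ) ^ i.1 / 2) (2 * 2 ^ i.1) ×ˢ Set.Icc ((2 : ℝ) ^ i.2 / 2) (2 * 2 ^ i.2)) :
    ((dyadicBump (t₁ / 2 ^ i.1) * dyadicBump (t₂ / 2 ^ i.2) *
        (((d₁ : ℝ) * t₁ * ((d₂ : ℝ) * t₂)) ^ (-(1 / 2 : ℝ)) * (r : ℝ)⁻¹) : ℝ) : ℂ) * ker t₂ σ = 0 := by
  have hθ : dyadicBump (t₁ / 2 ^ i.1) * dyadicBump (t₂ / 2 ^ i.2) = 0 := by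
    by_contra hne
    obtain ⟨⟨a1, a2⟩, ⟨b1, b2⟩⟩ := mem_box_of_bump₂_ne_zero hne
    exact h ⟨⟨a1.le, a2.le⟩, ⟨b1.le, b2.le⟩⟩
  rw [hθ, zero_mul, Complex.ofReal_zero, zero_mul]

/-- **Size of `K` on the box**: for `t` in `[K₁/2, 2K₁] × [K₂/2, 2K₂]` and `d₁, d₂ ≥ 1`,
`‖K(t)‖ ≤ (d₁(K₁/2)·d₂(K₂/2))^{−1/2}·r⁻¹` (`θ ≤ 1`, `|e(·)| = 1`, the power is decreasing). [folklore] -/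
theorem norm_levelWeight_le {d₁ d₂ : ℕ} (hd₁ : 1 ≤ d₁) (hd₂ : 1 ≤ d₂) (r : ℕ) (i : ℕ × ℕ) (σ : ℝ)
    {t₁ t₂ : ℝ} (ht₁ : t₁ ∈ Set.Icc ((2 : ℝ) ^ i.1 / 2) (2 * 2 ^ i.1))
    (ht₂ : t₂ ∈ Set.Icc ((2 : ℝ) ^ i.2 / 2) (2 * 2 ^ i.2)) :
    ‖((dyadicBump (t₁ / 2 ^ i.1) * dyadicBump (t₂ / 2 ^ i.2) *
        (((d₁ : ℝ) * t₁ * ((d₂ : ℝ) * t₂)) ^ (-(1 / 2 : ℝ)) * (r : ℝ)⁻¹) : ℝ) : ℂ) * ker t₂ σ‖ ≤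
      ((d₁ : ℝ) * (2 ^ i.1 / 2) * ((d₂ : ℝ) * (2 ^ i.2 / 2))) ^ (-(1 / 2 : ℝ)) * (r : ℝ)⁻¹ := by
  have hK₁ : (0 : ℝ) < 2 ^ i.1 / 2 := by positivity
  have hK₂ : (0 : ℝ) < 2 ^ i.2 / 2 := by positivity
  have ht₁0 : 0 < t₁ := lt_of_lt_of_le hK₁ ht₁.1
  have ht₂0 : 0 < t₂ := lt_of_lt_of_le hK₂ ht₂.1
  have hd₁0 : (0 : ℝ) < d₁ := by exact_mod_cast hd₁
  have hd₂0 : (0 : ℝ) < d₂ := by exact_mod_cast hd₂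
  have hθ0 : 0 ≤ dyadicBump (t₁ / 2 ^ i.1) * dyadicBump (t₂ / 2 ^ i.2) :=
    mul_nonneg (dyadicBump_nonneg _) (dyadicBump_nonneg _)
  have hθ1 : dyadicBump (t₁ / 2 ^ i.1) * dyadicBump (t₂ / 2 ^ i.2) ≤ 1 :=
    mul_le_one₀ (dyadicBump_le_one _) (dyadicBump_nonneg _) (dyadicBump_le_one _)
  have hP0 : 0 < (d₁ : ℝ) * t₁ * ((d₂ : ℝ) * t₂) := by positivity
  have hB0 : 0 < (d₁ : ℝ) * (2 ^ i.1 / 2) * ((d₂ : ℝ) * (2 ^ i.2 / 2)) := by positivity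
  -- the power is antitone in the base
  have hpow : ((d₁ : ℝ) * t₁ * ((d₂ : ℝ) * t₂)) ^ (-(1 / 2 : ℝ)) ≤
      ((d₁ : ℝ) * (2 ^ i.1 / 2) * ((d₂ : ℝ) * (2 ^ i.2 / 2))) ^ (-(1 / 2 : ℝ)) := by
    refine Real.rpow_le_rpow_of_nonpos hB0 ?_ (by norm_num)
    exact mul_le_mul (mul_le_mul_of_nonneg_left ht₁.1 hd₁0.le) (mul_le_mul_of_nonneg_left ht₂.1 hd₂0.le)
      (by positivity) (by positivity)
  have hC0 : 0 ≤ ((d₁ : ℝ) * t₁ * ((d₂ : ℝ) * t₂)) ^ (-(1 / 2 : ℝ)) * (r : ℝ)⁻¹ := by positivity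
  rw [norm_mul, norm_ker, mul_one, Complex.norm_real, Real.norm_eq_abs, abs_of_nonneg (mul_nonneg hθ0 hC0)]
  calc dyadicBump (t₁ / 2 ^ i.1) * dyadicBump (t₂ / 2 ^ i.2) *
        (((d₁ : ℝ) * t₁ * ((d₂ : ℝ) * t₂)) ^ (-(1 / 2 : ℝ)) * (r : ℝ)⁻¹)
      ≤ 1 * (((d₁ : ℝ) * t₁ * ((d₂ : ℝ) * t₂)) ^ (-(1 / 2 : ℝ)) * (r : ℝ)⁻¹) :=
        mul_le_mul_of_nonneg_right hθ1 hC0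
    _ ≤ ((d₁ : ℝ) * (2 ^ i.1 / 2) * ((d₂ : ℝ) * (2 ^ i.2 / 2))) ^ (-(1 / 2 : ℝ)) * (r : ℝ)⁻¹ := by
        rw [one_mul]
        exact mul_le_mul_of_nonneg_right hpow (by positivity)

end Summit.Parity.GeneralizedHardyLittlewood.Theorems.BeyondDiagonalBeatsQuarter.LevelSeparation

end
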